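import Literature.Geometry.Riemannian.RoundSurgeryModel
import Literature.Geometry.Riemannian.MetricGluing
import HarnessLib

/-!
# Weinstein's surgery on the manifold: the new metric and its polar chart

Topic `Geometry/Riemannian`. Given the round model of the surgery on a model open set
`Ũ : Opens V` (`RoundSurgeryModel.lean`) whose chart metric is the pullback of the ambient metric
`g₀` under a `C^∞` injective immersion `Φ_A : Ũ → M` (the tube map of the tour precomposed with
the linear rounding map), this file pushes the model forward (`MetricGluing.lean`) and delivers
the data of Weinstein's criterion (`WeinsteinCriterion.two_le_minimalGeodesicMultiplicity_of_radial`)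
for the new metric `g₁`: the centre `p = Φ_A 0`, the polar chart `F : E → M` with
`F 0 = p`, `dF₀ = id`, `C^∞`, injective with injective differentials on the `g₁(p)`-ball of
radius `r₁ = 1 + δ > 1`, the Gauss identities `g₁(dF_v v, dF_v v) = |v|²`, `g₁(dF_v v, dF_v β) = 0`
(`v ⊥ β`), the exit inequality at `R = 1`, and the locality of the modification: `g₁ = g₀` off a
compact set contained in `F(open unit ball)` (Weinstein 1968, proof of the main theorem, step (3)).

* `exists_surgery_data`.

## References

* A. Weinstein, Ann. of Math. (2) 87 (1968), 29–41, proof of the main theorem, step (3).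
  [cite: Weinstein1968]

Tags: [Surgery] [Weinstein1968]
-/

noncomputable section

open Bundle Set Function Filter TopologicalSpace Metric Module
open scoped Manifold ContDiff Topology RealInnerProductSpace

namespace Literature.Geometry.Riemannian

open Literature.Geometry.Lorentzian
open Literature.Geometry.Lorentzian.OpensChart
open Literature.Geometry.Lorentzian.PseudoRiemannianMetric

variable {E : Type*} [NormedAddCommGroup E] [NormedSpace ℝ E] [FiniteDimensional ℝ E]
  [CompleteSpace E] {H : Type*} [TopologicalSpace H] {I : ModelWithCorners ℝ E H} [I.Boundaryless]
  {M : Type*} [TopologicalSpace M] [ChartedSpace H M] [IsManifold I ∞ M] [T2Space M]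
  (g₀ : PseudoRiemannianMetric I ∞ E (TangentSpace I : M → Type _))
  {V : Type*} [NormedAddCommGroup V] [InnerProductSpace ℝ V] [FiniteDimensional ℝ V]
  {U : Opens V}
  (gU : PseudoRiemannianMetric 𝓘(ℝ, V) ∞ V (TangentSpace 𝓘(ℝ, V) : U → Type _)) [gU.HasLeviCivita]
  (GU : V → V →L[ℝ] V →L[ℝ] ℝ)

set_option maxHeartbeats 3200000 in
/-- **Weinstein's surgery on the manifold, with the tube region inside the new closed unit disk**
(last conjunct: `Φ_A(closedBall 0 1) ⊆ F({g₁(p)(v,v) ≤ 1})`). See the module docstring.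
[cite: Weinstein1968, proof of the main theorem, step (3)] -/
theorem exists_surgery_data_onto {d : ℕ} (hdimE : finrank ℝ V = d + 1)
    (hVE : finrank ℝ V = finrank ℝ E)
    (hG : ∀ y : U, gU.val y = GU y) (hgU : gU.IsRiemannian) (u₀ : U) {εU : ℝ} (hεU : 0 < εU)
    (hUball : ball (0 : V) (1 + εU) ⊆ (U : Set V))
    {ΦA : V → M} (hΦs : ContMDiffOn 𝓘(ℝ, V) I ∞ ΦA U) (hΦinj : InjOn ΦA U)
    (hΦd : ∀ y ∈ (U : Set V), Injective (mfderiv 𝓘(ℝ, V) I ΦA y))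
    (hpb : ∀ y ∈ (U : Set V), ∀ u w : V,
      GU y u w = g₀.val (ΦA y) (mfderiv 𝓘(ℝ, V) I ΦA y u) (mfderiv 𝓘(ℝ, V) I ΦA y w))
    (hq1 : ∀ p : U, ‖(p : V)‖ = 1 →
      1 ≤ GU p ((GU p).inverse (innerSL ℝ (p : V))) ((GU p).inverse (innerSL ℝ (p : V))))
    {lam : ℝ} (hlam : 0 ≤ lam)
    (hΓ : ∀ p : U, ‖(p : V)‖ = 1 → ∀ X : V,
      ⟪(p : V), christoffel gU GU p X X⟫ ≤
        lam * Real.sqrt (GU p ((GU p).inverse (innerSL ℝ (p : V))) ((GU p).inverse (innerSL ℝ (p : V)))) *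
          GU p X X)
    (hg₀ : g₀.IsRiemannian) :
    ∃ (g₁ : PseudoRiemannianMetric I ∞ E (TangentSpace I : M → Type _)) (F : E → M) (r₁ : ℝ),
      g₁.IsRiemannian ∧ 1 < r₁ ∧ F 0 = ΦA 0 ∧
      ContMDiffOn 𝓘(ℝ, E) I ∞ F {v : E | g₁.val (ΦA 0) v v < r₁ ^ 2} ∧
      (∀ w : E, mfderiv 𝓘(ℝ, E) I F 0 w = w) ∧
      InjOn F {v : E | g₁.val (ΦA 0) v v < r₁ ^ 2} ∧
      (∀ v : E, g₁.val (ΦA 0) v v < r₁ ^ 2 → Injective (mfderiv 𝓘(ℝ, E) I F v)) ∧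
      (∀ v : E, g₁.val (ΦA 0) v v < r₁ ^ 2 →
        g₁.val (F v) (mfderiv 𝓘(ℝ, E) I F v v) (mfderiv 𝓘(ℝ, E) I F v v) = g₁.val (ΦA 0) v v) ∧
      (∀ v β : E, g₁.val (ΦA 0) v v < r₁ ^ 2 → g₁.val (ΦA 0) v β = 0 →
        g₁.val (F v) (mfderiv 𝓘(ℝ, E) I F v v) (mfderiv 𝓘(ℝ, E) I F v β) = 0) ∧
      (∀ u w : E, g₁.val (ΦA 0) u u = 1 →
        -(lam * g₁.val (F ((1 : ℝ) • u)) (mfderiv 𝓘(ℝ, E) I F ((1 : ℝ) • u) ((1 : ℝ) • w))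
            (mfderiv 𝓘(ℝ, E) I F ((1 : ℝ) • u) ((1 : ℝ) • w))) ≤
          (1 / 2) * deriv (fun t : ℝ ↦ g₁.val (F (t • u)) (mfderiv 𝓘(ℝ, E) I F (t • u) (t • w))
            (mfderiv 𝓘(ℝ, E) I F (t • u) (t • w))) 1) ∧
      (∃ K : Set M, IsCompact K ∧ (∀ x : M, x ∉ K → g₁.val x = g₀.val x) ∧
        (∀ x ∈ K, ∃ v : E, g₁.val (ΦA 0) v v < 1 ∧ F v = x)) ∧
      ΦA '' closedBall (0 : V) 1 ⊆ F '' {v : E | g₁.val (ΦA 0) v v ≤ 1} := by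
  haveI : CompleteSpace V := FiniteDimensional.complete ℝ V
  have h0U : (0 : V) ∈ (U : Set V) := hUball (by rw [mem_ball_zero_iff, norm_zero]; linarith)
  /- ── the linear identification `L = (dΦ_A(0))⁻¹ : E ≃L V` ── -/
  set T₀ : V →L[ℝ] E := (mfderiv 𝓘(ℝ, V) I ΦA 0 : V →L[ℝ] E) with hT₀def
  have hT₀ : ∀ a : V, T₀ a = mfderiv 𝓘(ℝ, V) I ΦA 0 a := fun a ↦ rfl
  have hT₀bij : Bijective T₀ :=
    mfderiv_bijective_of_injective (I := I) (I' := 𝓘(ℝ, V)) (hΦd 0 h0U) hVE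
  set eT : V ≃L[ℝ] E := ContinuousLinearEquiv.ofBijective T₀
    (LinearMap.ker_eq_bot.2 hT₀bij.1) (LinearMap.range_eq_top.2 hT₀bij.2) with heT
  set L : E →L[ℝ] V := (eT.symm : E →L[ℝ] V) with hLdef
  have hTL : ∀ a : E, mfderiv 𝓘(ℝ, V) I ΦA 0 (L a) = a := fun a ↦ by
    rw [← hT₀]; exact ContinuousLinearEquiv.ofBijective_apply_symm_apply T₀ _ _ a
  have hLinj : Injective L := eT.symm.injective
  have hL0 : ∀ a : E, L a = 0 ↔ a = 0 := fun a ↦ by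
    constructor
    · intro h; exact hLinj (by rw [h, map_zero])
    · intro h; rw [h, map_zero]
  /- ── the round model ── -/
  obtain ⟨δ, hδ, Fm, P, hFs, hFid, hFinj, hFdinj, hFU, hPs, hPsymm, hPpos, hPin, hPvv, hPvβ, hPB,
    hPexit, hFonto⟩ := exists_roundSurgeryModel_onto gU GU hdimE hG hgU u₀ hεU hUball hq1 hlam hΓ
  have hδ4 : δ / 4 < δ := by linarith
  have hFm0 : Fm 0 = 0 := hFid 0 (by rw [norm_zero]; norm_num)
  have hFmid_ev : Fm =ᶠ[𝓝 (0 : V)] id := by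
    have hopen : IsOpen {v : V | ‖v‖ < 1 / 3} := isOpen_lt continuous_norm continuous_const
    filter_upwards [hopen.mem_nhds (show (0 : V) ∈ {v : V | ‖v‖ < 1 / 3} by
      simp only [mem_setOf_eq, norm_zero]; norm_num)] with v hv
    exact hFid v (le_of_lt hv)
  have hdFm0 : ∀ a : V, fderiv ℝ Fm 0 a = a := fun a ↦ by
    rw [hFmid_ev.fderiv_eq, fderiv_id]; rfl
  /- ── the maps `Ψ = Φ_A ∘ Fm ∘ L : E → M` and the model field on `E` ── -/
  set Ψ : E → M := fun x ↦ ΦA (Fm (L x)) with hΨdef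
  set PE : E → E →L[ℝ] E →L[ℝ] ℝ := fun x ↦ (((P (L x)).comp L).flip.comp L).flip with hPEdef
  have hPE : ∀ x a b : E, PE x a b = P (L x) (L a) (L b) := fun x a b ↦ rfl
  set D : Set E := {x : E | ‖L x‖ < 1 + δ} with hDdef
  set S : Set E := {x : E | ‖L x‖ < 1 - δ / 4} with hSdef
  set S' : Set E := {x : E | ‖L x‖ ≤ 1 - δ / 2} with hS'def
  have hLc : Continuous fun x : E ↦ ‖L x‖ := L.continuous.norm
  have hD : IsOpen D := isOpen_lt hLc continuous_const
  have hS : IsOpen S := isOpen_lt hLc continuous_const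
  have hS'cl : IsClosed S' := isClosed_le hLc continuous_const
  have hS'S : S' ⊆ S := fun x hx ↦ by
    simp only [hS'def, hSdef, mem_setOf_eq] at hx ⊢; linarith
  have hclS : closure S ⊆ {x : E | ‖L x‖ ≤ 1 - δ / 4} :=
    closure_minimal (fun x (hx : ‖L x‖ < 1 - δ / 4) ↦ show ‖L x‖ ≤ 1 - δ / 4 from le_of_lt hx)
      (isClosed_le hLc continuous_const)
  have hSD : closure S ⊆ D := fun x hx ↦ by
    have := hclS hx; simp only [mem_setOf_eq] at this; show ‖L x‖ < 1 + δ; linarith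
  have hDball : ∀ x ∈ D, L x ∈ ball (0 : V) (1 + δ) := fun x hx ↦ by
    rw [mem_ball_zero_iff]; exact hx
  -- compactness of `{‖L x‖ ≤ c}`
  have hcpt : ∀ c : ℝ, IsCompact {x : E | ‖L x‖ ≤ c} := by
    intro c
    haveI : ProperSpace E := FiniteDimensional.proper ℝ E
    apply Metric.isCompact_of_isClosed_isBounded (isClosed_le hLc continuous_const)
    rw [Metric.isBounded_iff_subset_closedBall (0 : E)]
    refine ⟨‖(eT : V →L[ℝ] E)‖ * max c 0, fun x hx ↦ ?_⟩
    rw [mem_closedBall, dist_zero_right]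
    have h1 : (eT : V →L[ℝ] E) (L x) = x := eT.apply_symm_apply x
    calc ‖x‖ = ‖(eT : V →L[ℝ] E) (L x)‖ := by rw [h1]
      _ ≤ ‖(eT : V →L[ℝ] E)‖ * ‖L x‖ := (eT : V →L[ℝ] E).le_opNorm _
      _ ≤ ‖(eT : V →L[ℝ] E)‖ * max c 0 :=
          mul_le_mul_of_nonneg_left ((show ‖L x‖ ≤ c from hx).trans (le_max_left _ _))
            (norm_nonneg _)
  have hSc : IsCompact (closure S) := (hcpt _).of_isClosed_subset isClosed_closure hclS
  /- ── smoothness and differentials of `Ψ` ── -/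
  have hFmL : ∀ x ∈ D, ContDiffAt ℝ ∞ (fun x : E ↦ Fm (L x)) x := by
    intro x hx
    exact (hFs.contDiffAt (isOpen_ball.mem_nhds (hDball x hx))).comp x L.contDiff.contDiffAt
  have hFmLU : ∀ x ∈ D, Fm (L x) ∈ (U : Set V) := fun x hx ↦ hFU _ (hDball x hx)
  have hΨs : ContMDiffOn 𝓘(ℝ, E) I ∞ Ψ D := by
    intro x hx
    have h1 : ContMDiffAt 𝓘(ℝ, V) I ∞ ΦA (Fm (L x)) := hΦs.contMDiffAt (U.2.mem_nhds (hFmLU x hx))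
    have h2 : ContMDiffAt 𝓘(ℝ, E) 𝓘(ℝ, V) ∞ (fun x : E ↦ Fm (L x)) x := (hFmL x hx).contMDiffAt
    exact (h1.comp x h2).contMDiffWithinAt
  -- the chain rule
  have hdΨ : ∀ x ∈ D, ∀ a : E, mfderiv 𝓘(ℝ, E) I Ψ x a =
      mfderiv 𝓘(ℝ, V) I ΦA (Fm (L x)) (fderiv ℝ Fm (L x) (L a)) := by
    intro x hx a
    have h1 : MDifferentiableAt 𝓘(ℝ, V) I ΦA (Fm (L x)) :=
      (hΦs.contMDiffAt (U.2.mem_nhds (hFmLU x hx))).mdifferentiableAt (by simp)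
    have h2d : DifferentiableAt ℝ (fun x : E ↦ Fm (L x)) x := (hFmL x hx).differentiableAt (by simp)
    have h2 : MDifferentiableAt 𝓘(ℝ, E) 𝓘(ℝ, V) (fun x : E ↦ Fm (L x)) x :=
      mdifferentiableAt_iff_differentiableAt.2 h2d
    have h3 : fderiv ℝ (fun x : E ↦ Fm (L x)) x a = fderiv ℝ Fm (L x) (L a) := by
      have hF : DifferentiableAt ℝ Fm (L x) :=
        (hFs.contDiffAt (isOpen_ball.mem_nhds (hDball x hx))).differentiableAt (by simp)
      rw [show (fun x : E ↦ Fm (L x)) = Fm ∘ L from rfl, fderiv_comp x hF L.differentiableAt,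
        L.fderiv]
      rfl
    have hc : mfderiv 𝓘(ℝ, E) I (ΦA ∘ fun x : E ↦ Fm (L x)) x =
        (mfderiv 𝓘(ℝ, V) I ΦA (Fm (L x))).comp (mfderiv 𝓘(ℝ, E) 𝓘(ℝ, V) (fun x : E ↦ Fm (L x)) x) :=
      mfderiv_comp x h1 h2
    show mfderiv 𝓘(ℝ, E) I (ΦA ∘ fun x : E ↦ Fm (L x)) x a = _
    rw [hc]
    show mfderiv 𝓘(ℝ, V) I ΦA (Fm (L x)) (mfderiv 𝓘(ℝ, E) 𝓘(ℝ, V) (fun x : E ↦ Fm (L x)) x a) = _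
    rw [mfderiv_eq_fderiv]
    exact congrArg (mfderiv 𝓘(ℝ, V) I ΦA (Fm (L x))) h3
  have hΨd : ∀ x ∈ D, Injective (mfderiv 𝓘(ℝ, E) I Ψ x) := by
    intro x hx a b hab
    rw [hdΨ x hx, hdΨ x hx] at hab
    have h1 := hΦd _ (hFmLU x hx) hab
    have h2 := hFdinj _ (hDball x hx) h1
    exact hLinj h2
  have hΨinj : InjOn Ψ D := by
    intro x hx y hy hxy
    have h1 := hΦinj (hFmLU x hx) (hFmLU y hy) hxy
    have h2 := hFinj (hDball x hx) (hDball y hy) h1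
    exact hLinj h2
  /- ── the model field on `E` ── -/
  have hPEs : ContDiffOn ℝ ∞ PE D := by
    rw [contDiffOn_clm_apply]; intro a
    rw [contDiffOn_clm_apply]; intro b
    have h1 : ContDiffOn ℝ ∞ (fun x : E ↦ P (L x)) D := by
      intro x hx
      exact ((hPs.contDiffAt (isOpen_ball.mem_nhds (hDball x hx))).comp x
        L.contDiff.contDiffAt).contDiffWithinAt
    exact ((h1.clm_apply contDiffOn_const).clm_apply contDiffOn_const).congr fun x _ ↦ hPE x a b
  have hPEsymm : ∀ x ∈ D, ∀ a b : E, PE x a b = PE x b a := fun x hx a b ↦ by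
    rw [hPE, hPE, hPsymm _ (hDball x hx)]
  have hPEpos : ∀ x ∈ D, ∀ a : E, a ≠ 0 → 0 < PE x a a := fun x hx a ha ↦ by
    rw [hPE]; exact hPpos _ (hDball x hx) _ (fun h ↦ ha ((hL0 a).1 h))
  have hPEeq : ∀ x ∈ D, x ∉ S' → ∀ a b : E,
      PE x a b = g₀.val (Ψ x) (mfderiv 𝓘(ℝ, E) I Ψ x a) (mfderiv 𝓘(ℝ, E) I Ψ x b) := by
    intro x hx hxS' a b
    have h1 : 1 - δ ≤ ‖L x‖ := by
      have : ¬ ‖L x‖ ≤ 1 - δ / 2 := hxS'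
      linarith [not_le.1 this]
    rw [hPE, hPB (L x) h1 hx, hpb _ (hFmLU x hx), hdΨ x hx a, hdΨ x hx b]
  /- ── gluing ── -/
  obtain ⟨g₁, hglue, hout, hRiem⟩ := exists_glued_metric g₀ hD hS hSD hSc hS'S hS'cl hΨs hΨinj hΨd
    hPEs hPEsymm hPEpos hPEeq
  have hg₁ : g₁.IsRiemannian := hRiem hg₀
  /- ── the centre ── -/
  have h0D : (0 : E) ∈ D := by
    show ‖L 0‖ < 1 + δ; rw [map_zero, norm_zero]; linarith
  have hΨ0 : Ψ 0 = ΦA 0 := by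
    show ΦA (Fm (L 0)) = ΦA 0; rw [map_zero, hFm0]
  have hdΨ0 : ∀ a : E, mfderiv 𝓘(ℝ, E) I Ψ 0 a = a := by
    intro a
    rw [hdΨ 0 h0D a]
    rw [map_zero, hdFm0, hFm0]
    exact hTL a
  -- the metric at the centre: `g₁(p)(a, b) = ⟪L a, L b⟫`
  have hgp : ∀ a b : E, g₁.val (ΦA 0) a b = ⟪L a, L b⟫ := by
    intro a b
    have h := hglue 0 h0D a b
    rw [hdΨ0, hdΨ0, hPE, map_zero, hPin 0 (by rw [norm_zero]; norm_num)] at h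
    rw [← hΨ0]
    exact h
  have hgpvv : ∀ v : E, g₁.val (ΦA 0) v v = ‖L v‖ ^ 2 := fun v ↦ by
    rw [hgp, real_inner_self_eq_norm_sq]
  set r₁ : ℝ := 1 + δ with hr₁
  have hballD : ∀ v : E, g₁.val (ΦA 0) v v < r₁ ^ 2 ↔ v ∈ D := by
    intro v
    rw [hgpvv]
    constructor
    · intro h
      show ‖L v‖ < 1 + δ
      nlinarith [norm_nonneg (L v), hδ]
    · intro h
      have h' : ‖L v‖ < 1 + δ := h
      have h0 : 0 ≤ ‖L v‖ := norm_nonneg _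
      nlinarith
  have hsetD : {v : E | g₁.val (ΦA 0) v v < r₁ ^ 2} = D := Set.ext fun v ↦ hballD v
  /- ── the conclusions ── -/
  refine ⟨g₁, Ψ, r₁, hg₁, by rw [hr₁]; linarith, hΨ0, by rw [hsetD]; exact hΨs, hdΨ0,
    by rw [hsetD]; exact hΨinj, fun v hv ↦ hΨd v ((hballD v).1 hv), ?_, ?_, ?_, ?_, ?_⟩
  · -- radial Gauss identity
    intro v hv
    have hvD := (hballD v).1 hv
    rw [hglue v hvD, hPE, hgpvv]
    by_cases hv0 : L v = 0
    · rw [hv0]; simp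
    · exact hPvv _ (hDball v hvD) hv0
  · -- angular Gauss identity
    intro v β hv hvβ
    have hvD := (hballD v).1 hv
    rw [hgp] at hvβ
    rw [hglue v hvD, hPE]
    by_cases hv0 : L v = 0
    · rw [hv0]; simp
    · exact hPvβ _ (hDball v hvD) hv0 _ hvβ
  · -- the exit inequality
    intro u w hu
    have hu1 : ‖L u‖ = 1 := by
      have h := hgpvv u; rw [hu] at h
      nlinarith [norm_nonneg (L u)]
    have huD : ((1 : ℝ) • u) ∈ D := by
      show ‖L ((1 : ℝ) • u)‖ < 1 + δ; rw [one_smul, hu1]; linarith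
    have hLHS : g₁.val (Ψ ((1 : ℝ) • u)) (mfderiv 𝓘(ℝ, E) I Ψ ((1 : ℝ) • u) ((1 : ℝ) • w))
        (mfderiv 𝓘(ℝ, E) I Ψ ((1 : ℝ) • u) ((1 : ℝ) • w)) = P (L u) (L w) (L w) := by
      rw [hglue _ huD, hPE, one_smul, one_smul]
    have hfun : (fun t : ℝ ↦ g₁.val (Ψ (t • u)) (mfderiv 𝓘(ℝ, E) I Ψ (t • u) (t • w))
        (mfderiv 𝓘(ℝ, E) I Ψ (t • u) (t • w))) =ᶠ[𝓝 1]
        fun t : ℝ ↦ P (t • L u) (t • L w) (t • L w) := by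
      filter_upwards [Ioo_mem_nhds (show 1 - δ < (1 : ℝ) by linarith) (show (1 : ℝ) < 1 + δ by linarith),
        Ioo_mem_nhds (show (1 : ℝ) / 2 < 1 by norm_num) (show (1 : ℝ) < 2 by norm_num)]
        with t ht ht'
      have htpos : 0 < t := by linarith [ht'.1]
      have htD : t • u ∈ D := by
        show ‖L (t • u)‖ < 1 + δ
        rw [map_smul, norm_smul, Real.norm_eq_abs, abs_of_pos htpos, hu1, mul_one]; exact ht.2
      rw [hglue _ htD, hPE, map_smul, map_smul]
    rw [hLHS, hfun.deriv_eq]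
    exact hPexit (L u) (L w) hu1
  · -- locality of the modification
    refine ⟨Ψ '' {x : E | ‖L x‖ ≤ 1 - δ / 4}, (hcpt _).image_of_continuousOn
      (hΨs.continuousOn.mono fun x hx ↦ ?_), fun x hx ↦ hout x fun h ↦ hx ?_, ?_⟩
    · show ‖L x‖ < 1 + δ; have : ‖L x‖ ≤ 1 - δ / 4 := hx; linarith
    · exact image_mono (fun y (hy : ‖L y‖ < 1 - δ / 4) ↦ show ‖L y‖ ≤ 1 - δ / 4 from le_of_lt hy) h
    · rintro x ⟨v, hv, rfl⟩
      refine ⟨v, ?_, rfl⟩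
      rw [hgpvv]
      have h : ‖L v‖ ≤ 1 - δ / 4 := hv
      have h0 : 0 ≤ ‖L v‖ := norm_nonneg _
      nlinarith
  · -- the round closed unit ball is covered by the new closed unit disk
    rintro _ ⟨y, hy, rfl⟩
    obtain ⟨w, hw, hwy⟩ := hFonto hy
    rw [mem_closedBall_zero_iff] at hw
    refine ⟨eT w, ?_, ?_⟩
    · show g₁.val (ΦA 0) (eT w) (eT w) ≤ 1
      rw [hgpvv]
      have hL : L (eT w) = w := eT.symm_apply_apply w
      rw [hL]
      nlinarith [norm_nonneg w]
    · show ΦA (Fm (L (eT w))) = ΦA y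
      have hL : L (eT w) = w := eT.symm_apply_apply w
      rw [hL, hwy]

set_option maxHeartbeats 400000 in
/-- **Weinstein's surgery on the manifold.** See the module docstring.
[cite: Weinstein1968, proof of the main theorem, step (3)] -/
theorem exists_surgery_data {d : ℕ} (hdimE : finrank ℝ V = d + 1)
    (hVE : finrank ℝ V = finrank ℝ E)
    (hG : ∀ y : U, gU.val y = GU y) (hgU : gU.IsRiemannian) (u₀ : U) {εU : ℝ} (hεU : 0 < εU)
    (hUball : ball (0 : V) (1 + εU) ⊆ (U : Set V))
    {ΦA : V → M} (hΦs : ContMDiffOn 𝓘(ℝ, V) I ∞ ΦA U) (hΦinj : InjOn ΦA U)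
    (hΦd : ∀ y ∈ (U : Set V), Injective (mfderiv 𝓘(ℝ, V) I ΦA y))
    (hpb : ∀ y ∈ (U : Set V), ∀ u w : V,
      GU y u w = g₀.val (ΦA y) (mfderiv 𝓘(ℝ, V) I ΦA y u) (mfderiv 𝓘(ℝ, V) I ΦA y w))
    (hq1 : ∀ p : U, ‖(p : V)‖ = 1 →
      1 ≤ GU p ((GU p).inverse (innerSL ℝ (p : V))) ((GU p).inverse (innerSL ℝ (p : V))))
    {lam : ℝ} (hlam : 0 ≤ lam)
    (hΓ : ∀ p : U, ‖(p : V)‖ = 1 → ∀ X : V,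
      ⟪(p : V), christoffel gU GU p X X⟫ ≤
        lam * Real.sqrt (GU p ((GU p).inverse (innerSL ℝ (p : V))) ((GU p).inverse (innerSL ℝ (p : V)))) *
          GU p X X)
    (hg₀ : g₀.IsRiemannian) :
    ∃ (g₁ : PseudoRiemannianMetric I ∞ E (TangentSpace I : M → Type _)) (F : E → M) (r₁ : ℝ),
      g₁.IsRiemannian ∧ 1 < r₁ ∧ F 0 = ΦA 0 ∧
      ContMDiffOn 𝓘(ℝ, E) I ∞ F {v : E | g₁.val (ΦA 0) v v < r₁ ^ 2} ∧
      (∀ w : E, mfderiv 𝓘(ℝ, E) I F 0 w = w) ∧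
      InjOn F {v : E | g₁.val (ΦA 0) v v < r₁ ^ 2} ∧
      (∀ v : E, g₁.val (ΦA 0) v v < r₁ ^ 2 → Injective (mfderiv 𝓘(ℝ, E) I F v)) ∧
      (∀ v : E, g₁.val (ΦA 0) v v < r₁ ^ 2 →
        g₁.val (F v) (mfderiv 𝓘(ℝ, E) I F v v) (mfderiv 𝓘(ℝ, E) I F v v) = g₁.val (ΦA 0) v v) ∧
      (∀ v β : E, g₁.val (ΦA 0) v v < r₁ ^ 2 → g₁.val (ΦA 0) v β = 0 →
        g₁.val (F v) (mfderiv 𝓘(ℝ, E) I F v v) (mfderiv 𝓘(ℝ, E) I F v β) = 0) ∧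
      (∀ u w : E, g₁.val (ΦA 0) u u = 1 →
        -(lam * g₁.val (F ((1 : ℝ) • u)) (mfderiv 𝓘(ℝ, E) I F ((1 : ℝ) • u) ((1 : ℝ) • w))
            (mfderiv 𝓘(ℝ, E) I F ((1 : ℝ) • u) ((1 : ℝ) • w))) ≤
          (1 / 2) * deriv (fun t : ℝ ↦ g₁.val (F (t • u)) (mfderiv 𝓘(ℝ, E) I F (t • u) (t • w))
            (mfderiv 𝓘(ℝ, E) I F (t • u) (t • w))) 1) ∧
      ∃ K : Set M, IsCompact K ∧ (∀ x : M, x ∉ K → g₁.val x = g₀.val x) ∧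
        (∀ x ∈ K, ∃ v : E, g₁.val (ΦA 0) v v < 1 ∧ F v = x) := by
  obtain ⟨g₁, F, r₁, h1, h2, h3, h4, h5, h6, h7, h8, h9, h10, h11, -⟩ :=
    exists_surgery_data_onto g₀ gU GU hdimE hVE hG hgU u₀ hεU hUball hΦs hΦinj hΦd hpb hq1 hlam hΓ hg₀
  exact ⟨g₁, F, r₁, h1, h2, h3, h4, h5, h6, h7, h8, h9, h10, h11⟩

end Literature.Geometry.Riemannian

end
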